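import Literature.NumberTheory.EllipticCurves.TateCurve.TateFormalSeries
import HarnessLib

/-!
# Evaluating the formal Tate series: `ev X̃`, `ev Ỹ`, `ev a₄ = a₄(q)`, `ev a₆ = a₆(q)` and
# `ev tateRel = (1−u)⁶ (Y² + XY − X³ − a₄X − a₆)` (Silverman ATAEC, proof of Thm. V.3.1 (c))

Topic `Literature/NumberTheory/EllipticCurves/TateCurve`, namespace
`Literature.NumberTheory.EllipticCurves.TateCurve` (abc-iut cell, TRANCHE-T1 P21; sub-lemma U-2b,
second half; see `TateFormalSeries` for the definitions and the convergence estimates).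

For ANY complete normed field `𝕜` (so for `ℂ` and for `p`-adic fields alike), `u ∈ 𝕜ˣ` and
`‖q‖ < ‖u‖ < ‖q‖⁻¹`:
* `ev_xForm` : `ev X̃ u q = u + (1−u)² Σ_d c_d(u) q^{d+1}` (coefficients in the shape of
  `tateX_eq_annulus`); `ev_yForm` likewise; `ev_a4Form = tateA4 q`, `ev_a6Form = tateA6 q`;
* `ev_tateRel` : if `(1−u)²X = ev X̃` and `(1−u)³Y = ev Ỹ` then
  `ev tateRel u q = (1−u)⁶ (Y² + XY − X³ − tateA4 q · X − tateA6 q)`; `evSummable_tateRel`.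

## References
* [SilvermanATAEC1994] J. H. Silverman, *Advanced Topics in the Arithmetic of Elliptic Curves*,
  GTM 151, Springer 1994, proof of Thm. V.3.1 (c) (PDF pp. 396–397).
-/

noncomputable section

open LaurentPolynomial PowerSeries Finset
open scoped ArithmeticFunction.sigma

namespace Literature.NumberTheory.EllipticCurves.TateCurve

open SteinWuthrich2013

variable {𝕜 : Type*} [NormedField 𝕜] [CompleteSpace 𝕜] (u : 𝕜ˣ) {q : 𝕜}


/-- **`ev X̃ = u + (1−u)² Σ_d c_d(u) q^{d+1}`** on the annulus (coefficients in the shape of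
`tateX_eq_annulus`). [cite: SilvermanATAEC1994, Thm. V.3.1 (c) (proof, PDF p. 397)] -/
theorem ev_xForm (hqu : ‖q‖ < ‖(u : 𝕜)‖) (huq : ‖(u : 𝕜)‖ < ‖q‖⁻¹) :
    ev xForm u q = (u : 𝕜) + (1 - (u : 𝕜)) ^ 2 *
      ∑' d : ℕ, (∑ m ∈ (d + 1).divisors, ((m : ℕ) : 𝕜) * ((u : 𝕜) ^ m + (u : 𝕜)⁻¹ ^ m - 2))
        * q ^ (d + 1) := by
  have hs := Summable.of_norm (evSummable_xForm u hqu huq)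
  rw [ev, hs.tsum_eq_zero_add, evTerm_xForm_zero]
  congr 1
  rw [← tsum_mul_left]
  exact tsum_congr fun d ↦ evTerm_xForm_succ u d

/-- **`ev Ỹ = u² + (1−u)³ Σ_d c'_d(u) q^{d+1}`** on the annulus (shape of `tateY_eq_annulus`).
[cite: SilvermanATAEC1994, Thm. V.3.1 (c) (proof, PDF p. 397)] -/
theorem ev_yForm (hqu : ‖q‖ < ‖(u : 𝕜)‖) (huq : ‖(u : 𝕜)‖ < ‖q‖⁻¹) :
    ev yForm u q = (u : 𝕜) ^ 2 + (1 - (u : 𝕜)) ^ 3 *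
      ∑' d : ℕ, (∑ m ∈ (d + 1).divisors, ((((m.choose 2 : ℕ)) : 𝕜) * (u : 𝕜) ^ m
        - (((m + 1).choose 2 : ℕ) : 𝕜) * (u : 𝕜)⁻¹ ^ m + (m : 𝕜))) * q ^ (d + 1) := by
  have hs := Summable.of_norm (evSummable_yForm u hqu huq)
  rw [ev, hs.tsum_eq_zero_add, evTerm_yForm_zero]
  congr 1
  rw [← tsum_mul_left]
  exact tsum_congr fun d ↦ evTerm_yForm_succ u d

/-- `ev a4Form u q = tateA4 q = −5 s₃(q)`. [cite: SilvermanATAEC1994, Thm. V.3.1 (a) (PDF p. 395)] -/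
theorem ev_a4Form (hq : ‖q‖ < 1) : ev a4Form u q = tateA4 q := by
  have h := (hasSum_tateS (K := 𝕜) 3 hq).mul_left (-5)
  rw [tateA4, ← h.tsum_eq, ev, (Summable.of_norm (evSummable_a4Form u hq)).tsum_eq_zero_add,
    evTerm, coeff_a4Form_zero, map_zero, zero_mul, zero_add]
  refine tsum_congr fun d ↦ ?_
  rw [evTerm, coeff_a4Form_succ, evCoeff_C]
  push_cast
  ring

/-- `ev a6Form u q = tateA6 q = −(5 s₃(q) + 7 s₅(q))/12` (for `12 ≠ 0` in `𝕜`).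
[cite: SilvermanATAEC1994, Thm. V.3.1 (a) (PDF p. 395)] -/
theorem ev_a6Form (hq : ‖q‖ < 1) (h12 : (12 : 𝕜) ≠ 0) : ev a6Form u q = tateA6 q := by
  rw [tateA6_eq_tsum hq h12, ev, (Summable.of_norm (evSummable_a6Form u hq)).tsum_eq_zero_add,
    evTerm, coeff_a6Form_zero, map_zero, zero_mul, zero_add, ← tsum_neg]
  refine tsum_congr fun d ↦ ?_
  rw [evTerm, coeff_a6Form_succ, evCoeff_C, Int.cast_neg, neg_mul]

omit [CompleteSpace 𝕜] in
/-- `ev (1 − u) = 1 − u`. [cite: SilvermanATAEC1994, Thm. V.3.1 (c) (proof, PDF p. 397)] -/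
theorem ev_oneSubU : ev oneSubU u q = 1 - (u : 𝕜) := by
  rw [oneSubU, ev_C, map_sub, map_one, evCoeff_T, zpow_one]

/-- `tateRel` converges absolutely on the annulus. [cite: SilvermanATAEC1994, Thm. V.3.1 (c) (proof, PDF p. 397)] -/
theorem evSummable_tateRel (hqu : ‖q‖ < ‖(u : 𝕜)‖) (huq : ‖(u : 𝕜)‖ < ‖q‖⁻¹) :
    EvSummable tateRel u q := by
  have hq : ‖q‖ < 1 := norm_lt_one_of_annulus' u hqu huq
  have sX := evSummable_xForm u hqu huq
  have sY := evSummable_yForm u hqu huq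
  have s4 := evSummable_a4Form u hq
  have s6 := evSummable_a6Form u hq
  have s1 : EvSummable oneSubU u q := EvSummable.C u q _
  exact ((((sY.pow u q 2).add u q ((s1.mul u q sX).mul u q sY)).sub u q (sX.pow u q 3)).sub u q
    (((s1.pow u q 4).mul u q s4).mul u q sX)).sub u q ((s1.pow u q 6).mul u q s6)

/-- **The formal Tate relation evaluates to `(1−u)⁶ (Y² + XY − X³ − a₄X − a₆)`** whenever
`(1−u)²X = ev X̃` and `(1−u)³Y = ev Ỹ` (any complete normed field, on the annulus, `12 ≠ 0`).
[cite: SilvermanATAEC1994, Thm. V.3.1 (c) (proof, PDF p. 397)] -/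
theorem ev_tateRel (hqu : ‖q‖ < ‖(u : 𝕜)‖) (huq : ‖(u : 𝕜)‖ < ‖q‖⁻¹) (h12 : (12 : 𝕜) ≠ 0)
    {X Y : 𝕜} (hX : (1 - (u : 𝕜)) ^ 2 * X = ev xForm u q)
    (hY : (1 - (u : 𝕜)) ^ 3 * Y = ev yForm u q) :
    ev tateRel u q =
      (1 - (u : 𝕜)) ^ 6 * (Y ^ 2 + X * Y - X ^ 3 - tateA4 q * X - tateA6 q) := by
  have hq : ‖q‖ < 1 := norm_lt_one_of_annulus' u hqu huq
  have sX := evSummable_xForm u hqu huq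
  have sY := evSummable_yForm u hqu huq
  have s4 := evSummable_a4Form u hq
  have s6 := evSummable_a6Form u hq
  have s1 : EvSummable oneSubU u q := EvSummable.C u q _
  -- summability of the five summands
  have t1 : EvSummable (yForm ^ 2) u q := sY.pow u q 2
  have t2 : EvSummable (oneSubU * xForm * yForm) u q := (s1.mul u q sX).mul u q sY
  have t3 : EvSummable (xForm ^ 3) u q := sX.pow u q 3
  have t4 : EvSummable (oneSubU ^ 4 * a4Form * xForm) u q := ((s1.pow u q 4).mul u q s4).mul u q sX
  have t5 : EvSummable (oneSubU ^ 6 * a6Form) u q := (s1.pow u q 6).mul u q s6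
  rw [tateRel, ev_sub u q (((t1.add u q t2).sub u q t3).sub u q t4) t5,
    ev_sub u q ((t1.add u q t2).sub u q t3) t4, ev_sub u q (t1.add u q t2) t3,
    ev_add u q t1 t2, ev_pow u q sY, ev_mul u q (s1.mul u q sX) sY, ev_mul u q s1 sX,
    ev_pow u q sX, ev_mul u q ((s1.pow u q 4).mul u q s4) sX, ev_mul u q (s1.pow u q 4) s4,
    ev_pow u q s1, ev_mul u q (s1.pow u q 6) s6, ev_pow u q s1, ev_oneSubU, ev_a4Form u hq,
    ev_a6Form u hq h12, ← hX, ← hY]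
  ring

end Literature.NumberTheory.EllipticCurves.TateCurve

end
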